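import Summits.QuantumFields.YangMills.Theorems.SwapVirialDeficitBlowUpChartDeficitGrowth
import Summits.QuantumFields.YangMills.Theorems.SwapVirialDeficitSwapRingCommBox
import HarnessLib

/-!
# The chart deficit is TWO-SIDED EQUIVALENT to the box: `F̂(C,U) ≤ 300·L⁴·(t + s)²` on {relations ≤ s, followers within t of 1} — in particular the
# THIN-TORON ENERGY `F̂(C, 1) ≤ 300·L⁴·s²` (the `f₀` of ✓`inner_ge_of_growth_of_taylor_offset` on the near-flat base `N`)
# (free-hands support of ⟨stmt-QuantumFields-24197⟩ `SwapVirialDeficit.SwapGluedStiffness`; input §4(a)/(c) of w2 g58's Morse–Bott road v2)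

w3 g61's ring-level ✓`SwapRing.swapRingDeficit_le_of_commBox` (`F^S_0(glue w ∷ r, g) ≤ 300·L⁴·(t₂ + s)²` on the σ-twisted nearly-commuting box in tree-gauge
coordinates) read in w2 g57's ring chart `q = (C, U) ↦ fixHistory (ringConfig 1 q)` — the converse direction of ✓`chartBox_of_chartDeficit` ∕
✓`…ChartDeficitGrowth`:

* ★★ `chartDeficit_le_of_box` — `‖[C_μ,C_ν]‖_F ≤ s`, `‖c·C_{σμ} − C_μ·c‖_F ≤ s`, `‖U_i − 1‖_F ≤ t` (all `i : Fol L`) ⟹ `F̂(C,U) ≤ 300·L⁴·(t + s)²`;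
* ★★ `chartDeficit_one_le_of_relations` — the THIN-TORON energy: `F̂(C, 1) ≤ 300·L⁴·s²` for every leader tuple whose twelve σ-relations are `≤ s` in Frobenius norm.
  With ✓`relations_sq_sum_le_chartDeficit` (`Φ(C) ≤ 43200L⁶F̂`) the deficit at `U ≡ 1` and the relation energy `Φ(C) = Σ‖relations‖²_F` are POLYNOMIALLY EQUIVALENT
  (`Φ/(43200L⁶) ≤ F̂(C,1) ≤ 300L⁴·12·Φ`… via `s² ≤ Φ ≤ 12 s²`), uniformly in the hub angle — so the near-flat base `N = {Φ < ρ₀²}` of architecture v2 is equally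
  `{F̂(C,1) < poly·ρ₀²}`, and on it `f₀ = F̂(C,1) ≤ μ²/(16B₄)` holds as soon as `ρ₀² ≤ μ²/(4800·L⁴·B₄)` (all poly(L)).

HONEST LABEL: bookkeeping (a landed ring-level inequality read in the chart); ⟨24197⟩ (window-uniform) ∕ ⟨24196⟩ ∕ ⟨24194⟩ ∕ ⟨24497⟩ OPEN; own crux ⟨22884⟩ OPEN
(blocked-on ⟨19935⟩); no crux, rung of record or summit is proved; the Yang–Mills mass gap is NOT proved; no summit is proved by a line.  THEOREMS ONLY
(0 `def`, 0 `sorry`), standard axioms.  Width seat ym-line-sfw-p2-w3 g65 (cell ym-idea-1, free hands), `--supports stmt-QuantumFields-24197`.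
References: [cite: Luscher1983, §2]; [cite: tHooft1979]; [folklore].
-/

set_option autoImplicit false

noncomputable section

open MeasureTheory
open scoped BigOperators
open Literature.MathematicalPhysics.QuantumFieldTheory hiding SU2
open Literature.MathematicalPhysics.QuantumLattice

namespace Summit.QuantumFields.YangMills.Theorems.SwapVirialDeficit.BlowUpRing

open Summit.QuantumFields.YangMills.Theorems.FemtoTransferGap
open Summit.QuantumFields.YangMills.Theorems.FemtoTransferGap.TT
open Summit.QuantumFields.YangMills.Theorems.VirialFluxGap.RingDeficit
open Summit.QuantumFields.YangMills.Theorems.VirialFluxGap.FixSplit (FixSpace)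
open Summit.QuantumFields.YangMills.Theorems.SwapTwistDeficit.PeriodicRingFloor
open Summit.QuantumFields.YangMills.Theorems.SwapVirialDeficit.SwapRing

variable {L : ℕ} [NeZero L]

/-- ★★ **THE BOX BOUNDS THE CHART DEFICIT**: for `q = (C, U)`, `0 ≤ t, s`, if `‖C_μC_ν − C_νC_μ‖_F ≤ s` (all `μ, ν`), `‖c·C_{σμ} − C_μ·c‖_F ≤ s` (all `μ`,
`c = C 3`) and `‖U_i − 1‖_F ≤ t` (all followers `i`), then `F̂(C,U) = chartDeficit L 0 1 q ≤ 300·L⁴·(t + s)²`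
(✓`SwapRing.swapRingDeficit_le_of_commBox` in the ring chart: the followers ARE the relative box coordinates). [cite: Luscher1983, §2] [cite: tHooft1979] -/
theorem chartDeficit_le_of_box (q : (Fin 4 → SU2) × (Fol L → SU2)) {t s : ℝ} (ht : 0 ≤ t) (hs : 0 ≤ s)
    (hCC : ∀ μ ν : Fin 3, frobNorm (((q.1 (Fin.castSucc μ) * q.1 (Fin.castSucc ν) : SU2) : Matrix (Fin 2) (Fin 2) ℂ) -
        ((q.1 (Fin.castSucc ν) * q.1 (Fin.castSucc μ) : SU2) : Matrix (Fin 2) (Fin 2) ℂ)) ≤ s)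
    (hσ : ∀ μ : Fin 3, frobNorm (((q.1 (Fin.last 3) * q.1 (Fin.castSucc (Equiv.swap (0 : Fin 3) 1 μ)) : SU2) : Matrix (Fin 2) (Fin 2) ℂ) -
        ((q.1 (Fin.castSucc μ) * q.1 (Fin.last 3) : SU2) : Matrix (Fin 2) (Fin 2) ℂ)) ≤ s)
    (hU : ∀ i : Fol L, frobNorm (((q.2 i : SU2) : Matrix (Fin 2) (Fin 2) ℂ) - 1) ≤ t) :
    chartDeficit L (fun _ => false) (fun _ => 1) q ≤ 300 * (L : ℝ) ^ 4 * (t + s) ^ 2 := by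
  have hF : swapRingDeficit L (fun _ => false) ((Fin.cons (glue (ringConfig (fun _ => 1) q).1) (ringConfig (fun _ => 1) q).2.1 :
      Fin (2 * L - 1 + 1) → GaugeConfig 3 L SU2), (ringConfig (fun _ => 1) q).2.2) = chartDeficit L (fun _ => false) (fun _ => 1) q := rfl
  rw [← hF]
  refine swapRingDeficit_le_of_commBox ht hs (ringConfig (fun _ => 1) q).1 (ringConfig (fun _ => 1) q).2.1 (ringConfig (fun _ => 1) q).2.2
    (fun μ ν => ?_) (fun μ => ?_) (fun i => ?_) (fun j e => ?_) (fun x => ?_)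
  · simpa only [ringConfig_fst_lead] using hCC μ ν
  · simpa only [ringConfig_fst_lead, ringConfig_snd_snd_zero] using hσ μ
  · by_cases hi : isLead i = true
    · -- a leader is its own letter: the relative coordinate is `1`
      have hcond : i.1.1 i.1.2 = -1 := apply_eq_neg_one_of_isLead hi
      have heq : (⟨(Pi.single i.1.2 (-1 : ZMod L), i.1.2), leader_not_treeEdge i.1.2⟩ : OffIdx L) = i := (eq_lead_of_isLead hi).symm
      rw [if_pos hcond, heq, inv_mul_cancel, OneMemClass.coe_one, sub_self, frobNorm_zero]
      exact ht
    · have h := hU (Sum.inl ⟨i, hi⟩)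
      have hw : (ringConfig (fun _ => (1 : SU2)) q).1 i = letter (fun μ => q.1 (Fin.castSucc μ)) i * q.2 (Sum.inl ⟨i, hi⟩) :=
        ringConfig_fst_of_not_isLead (fun _ => 1) q ⟨i, hi⟩
      have hl : (if i.1.1 i.1.2 = -1 then (ringConfig (fun _ => (1 : SU2)) q).1 ⟨(Pi.single i.1.2 (-1 : ZMod L), i.1.2), leader_not_treeEdge i.1.2⟩
          else 1) = letter (fun μ => q.1 (Fin.castSucc μ)) i := by
        simp only [ringConfig_fst_lead]; rfl
      rw [hl, hw, inv_mul_cancel_left]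
      exact h
  · have h := hU (Sum.inr (Sum.inl (j, e)))
    rwa [ringConfig_snd_fst, inv_mul_cancel_left]
  · by_cases hx : x = 0
    · subst hx
      rw [inv_mul_cancel, OneMemClass.coe_one, sub_self, frobNorm_zero]
      exact ht
    · have h := hU (Sum.inr (Sum.inr ⟨x, hx⟩))
      have hg : (ringConfig (fun _ => (1 : SU2)) q).2.2 x = (1 : SU2) * q.1 (Fin.last 3) * q.2 (Sum.inr (Sum.inr ⟨x, hx⟩)) :=
        ringConfig_snd_snd_of_ne (fun _ => 1) q ⟨x, hx⟩
      rwa [hg, ringConfig_snd_snd_zero, one_mul, inv_mul_cancel_left]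

/-- ★★ **THE THIN-TORON ENERGY**: for every leader tuple `C` whose twelve σ-relations are `≤ s` in Frobenius norm (`0 ≤ s`),
`F̂(C, 1) = chartDeficit L 0 1 (C, 1) ≤ 300·L⁴·s²` — the deficit of the rebuilt ring with ALL followers at their references (the thin toron of the tree gauge)
is polynomially small in the relation size, uniformly in the hub angle: the `f₀` of ✓`QuantitativeLaplace.inner_ge_of_growth_of_taylor_offset` on the near-flat
base `N`. [cite: Luscher1983, §2] [cite: tHooft1979] -/
theorem chartDeficit_one_le_of_relations (C : Fin 4 → SU2) {s : ℝ} (hs : 0 ≤ s)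
    (hCC : ∀ μ ν : Fin 3, frobNorm (((C (Fin.castSucc μ) * C (Fin.castSucc ν) : SU2) : Matrix (Fin 2) (Fin 2) ℂ) -
        ((C (Fin.castSucc ν) * C (Fin.castSucc μ) : SU2) : Matrix (Fin 2) (Fin 2) ℂ)) ≤ s)
    (hσ : ∀ μ : Fin 3, frobNorm (((C (Fin.last 3) * C (Fin.castSucc (Equiv.swap (0 : Fin 3) 1 μ)) : SU2) : Matrix (Fin 2) (Fin 2) ℂ) -
        ((C (Fin.castSucc μ) * C (Fin.last 3) : SU2) : Matrix (Fin 2) (Fin 2) ℂ)) ≤ s) :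
    chartDeficit L (fun _ => false) (fun _ => 1) (C, fun _ => 1) ≤ 300 * (L : ℝ) ^ 4 * s ^ 2 := by
  have h := chartDeficit_le_of_box (L := L) (C, fun _ => 1) le_rfl hs hCC hσ
    (fun i => by rw [OneMemClass.coe_one, sub_self, frobNorm_zero])
  simpa only [zero_add] using h

/-- ★ **Two-sided**: the deficit at `U ≡ 1` and the relation energy are polynomially equivalent — lower half restated from ✓`relations_sq_sum_le_chartDeficit`:
`Σ‖[C_μ,C_ν]‖²_F + Σ‖cC_{σμ} − C_μc‖²_F ≤ 43200·L⁶·F̂(C, 1)`. [cite: Luscher1983, §2] -/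
theorem relations_sq_sum_le_chartDeficit_one (C : Fin 4 → SU2) :
    (∑ μ : Fin 3, ∑ ν : Fin 3, frobNorm (((C (Fin.castSucc μ) * C (Fin.castSucc ν) : SU2) : Matrix (Fin 2) (Fin 2) ℂ) -
        ((C (Fin.castSucc ν) * C (Fin.castSucc μ) : SU2) : Matrix (Fin 2) (Fin 2) ℂ)) ^ 2) +
      ∑ μ : Fin 3, frobNorm (((C (Fin.last 3) * C (Fin.castSucc (Equiv.swap (0 : Fin 3) 1 μ)) : SU2) : Matrix (Fin 2) (Fin 2) ℂ) -
        ((C (Fin.castSucc μ) * C (Fin.last 3) : SU2) : Matrix (Fin 2) (Fin 2) ℂ)) ^ 2 ≤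
      43200 * (L : ℝ) ^ 6 * chartDeficit L (fun _ => false) (fun _ => 1) (C, fun _ => 1) :=
  relations_sq_sum_le_chartDeficit (L := L) (C, fun _ => 1)

end Summit.QuantumFields.YangMills.Theorems.SwapVirialDeficit.BlowUpRing

end
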